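import Summits.CriticalPhenomena.PercolationContinuityZ3.Theorems.Transplant.SiteUnfoldTools
import HarnessLib

/-!
# SITE percolation: the two-cluster Gibbs sampler of van den Berg–Häggström–Kahn §2.1 in SITE form — the half-step identity
# (Lemma 2.4 summed), the chain, its stationarity and its regeneration contraction
# (WP1 of P1-SITE-Z3 §12/§15, part 1; site twin of `Literature/Probability/Percolation/TwoClusterGibbsSampler.lean` §§Sums/Chain)

builds on p205010 (kernel theorem, internal audit signed; external expert review pending).

Sum level (`BHK2006.weight w`, `Σ weight = 1`), configurations `ζ : Set V` (open vertices).  States of the chain are pairs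
`(C_S, C_T)` of site set-clusters `C_S = SiteBHK.setC Γ univ S ζ`; given `C_S = A` the configuration off the DEAD SET
`SiteBHK.deadOf Γ S A = S ∪ A ∪ ∂A` is fresh (site Lemma 2.4 = `SiteCSH.set_sum_cond`, p214462), so the `T`-half-step resamples
`C_T` as the cluster of `T` in `η ∖ deadOf S A` for a fresh `η`.  OURS (the printed chain is for bond / random-cluster measures):
* `set_sum_cond_cluster`, `set_sum_cond_cluster'` — the two half-step identities on `D = {S ↮ T}`;
* `halfT`, `halfS`, `gibbsStep`, `gibbsE`, `regenT T = {all of T closed}`, `regenWeight`; monotonicity (Remark 2.8);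
* `gibbsE_stationary`, `gibbsE_iterate_stationary` ("`φ̂` is stationary for this chain");
* `gibbsE_sub_le`, `gibbsE_iterate_sub_le` — Doeblin contraction by `1 − ε`, `ε = regenWeight` (on the regeneration event the
  `T`-half-step returns the EMPTY cluster whatever the state was).
Definitions + proofs (`--supports stmt-CriticalPhenomena-4575 --as helper`); no named facts, no sorries.
[cite: VandenbergHaggstromKahn2005, §2.1 pp. 9–13 (Lemmas 2.3–2.4, the chain, Claim 2.5, Remark 2.8)]
-/

noncomputable section

namespace Summit.CriticalPhenomena.PercolationContinuityZ3.Theorems.Transplant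

namespace SiteGibbs

open MeasureTheory Set
open Literature.Probability.Percolation
open Literature.Probability.Percolation.BHK2006 (weight weight_nonneg)
open Literature.Probability.Percolation.DecisionTree (ind ind_of_mem ind_of_not_mem ind_nonneg)
open SiteBHK (setC deadOf mem_setC sC_univ)
open SiteCSH (worldDead worldDead_eq_deadOf set_sum_cond siteCluster_world_of_avoid siteRel_symm)
open scoped Classical

variable {V : Type*} {Γ : SimpleGraph V}

/-! ### The site chain: half-steps, one step, regeneration -/

variable (Γ) in
/-- **The `T`-half-step of the site chain**: given `C_S = A`, the new `C_T` is the site cluster of `T` in a FRESH configuration `η`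
read off the dead set `S ∪ A ∪ ∂A`. [cite: VandenbergHaggstromKahn2005, §2.1 pp. 10–11 (definition of the chain), Lemma 2.4 (p. 10)] -/
def halfT [Fintype V] (S T : Set V) (A η : Set V) : Set V := setC Γ Finset.univ T (η \ deadOf Γ S A)

variable (Γ) in
/-- **The `S`-half-step of the site chain**: given `C_T = B`, the new `C_S` is the site cluster of `S` in a fresh configuration read off
the dead set of `B`. [cite: VandenbergHaggstromKahn2005, §2.1 p. 11] -/
def halfS [Fintype V] (S T : Set V) (B η : Set V) : Set V := setC Γ Finset.univ S (η \ deadOf Γ T B)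

variable (Γ) in
/-- **One step of the site chain** from the state `x = (C_S, C_T)`, driven by the fresh configurations `(η, η')`.
[cite: VandenbergHaggstromKahn2005, §2.1 pp. 10–11] -/
def gibbsStep [Fintype V] (S T : Set V) (x : Set V × Set V) (η η' : Set V) : Set V × Set V :=
  (halfS Γ S T (halfT Γ S T x.1 η) η', halfT Γ S T x.1 η)

/-- **Regeneration (site)**: the fresh configurations in which every vertex of `T` is closed. [folklore] -/
def regenT (T : Set V) : Set (Set V) := {η | ∀ t ∈ T, t ∉ η}

/-- The dead set is monotone in the cluster value. [folklore] -/
theorem deadOf_mono' (N : Set V) {W W' : Set V} (h : W ⊆ W') : deadOf Γ N W ⊆ deadOf Γ N W' := by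
  rintro u (hu | hu | ⟨c, hc, huc⟩)
  · exact Or.inl hu
  · exact Or.inr (Or.inl (h hu))
  · exact Or.inr (Or.inr ⟨c, h hc, huc⟩)

variable [Fintype V]

/-- `halfT` is decreasing in the conditioning cluster and increasing in the fresh configuration (Remark 2.8).
[cite: VandenbergHaggstromKahn2005, §2.1 Remark 2.8 (p. 12)] -/
theorem halfT_mono (S T : Set V) {A A' η η' : Set V} (hA : A ⊆ A') (hη : η' ⊆ η) :
    halfT Γ S T A' η' ⊆ halfT Γ S T A η :=
  SiteBHK.setC_mono Finset.univ T (Set.sdiff_subset_sdiff hη (deadOf_mono' S hA))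

/-- `halfS` is decreasing in the conditioning cluster and increasing in the fresh configuration. [cite: VandenbergHaggstromKahn2005, §2.1 Remark 2.8 (p. 12)] -/
theorem halfS_mono (S T : Set V) {B B' η η' : Set V} (hB : B ⊆ B') (hη : η' ⊆ η) :
    halfS Γ S T B' η' ⊆ halfS Γ S T B η :=
  SiteBHK.setC_mono Finset.univ S (Set.sdiff_subset_sdiff hη (deadOf_mono' T hB))

/-- On the regeneration event the `T`-half-step forgets the past: the new `C_T` is empty. [folklore] -/
theorem halfT_of_mem_regenT (S T : Set V) {η : Set V} (hη : η ∈ regenT T) (A : Set V) : halfT Γ S T A η = ∅ :=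
  Set.eq_empty_of_forall_notMem fun _ ⟨t, ht, hu⟩ => hη t ht hu.1.1.1

/-- On the regeneration event the whole step forgets the past. [folklore] -/
theorem gibbsStep_of_mem_regenT (S T : Set V) {η : Set V} (hη : η ∈ regenT T) (x : Set V × Set V) (η' : Set V) :
    gibbsStep Γ S T x η η' = (halfS Γ S T ∅ η', ∅) := by
  simp only [gibbsStep, halfT_of_mem_regenT S T hη]

variable (Γ) in
/-- **The one-step operator of the site chain**: `(E Φ)(x) = Σ_η w(η) Σ_η' w(η') Φ(step x η η')`. [cite: VandenbergHaggstromKahn2005, §2.1 pp. 10–11] -/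
def gibbsE (w : V → ℝ) (S T : Set V) (Φ : Set V × Set V → ℝ) : Set V × Set V → ℝ :=
  fun x => ∑ η, weight w η * ∑ η', weight w η' * Φ (gibbsStep Γ S T x η η')

/-- The weight `ε = Σ_η w(η) 1{η ∈ regenT T}` of the regeneration event (`= ∏_{t ∈ T} (1 − w t)`). [folklore] -/
def regenWeight (w : V → ℝ) (T : Set V) : ℝ := ∑ η, weight w η * ind (regenT T) η

/-! ### Conditioning on `C_S` (site Lemma 2.4, summed, two-cluster form) -/

/-- On `{S ↮ T}` the site world of `S` does not change the cluster of `T`. [folklore] -/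
theorem setC_world_eq_of_notJoined {S T : Set V} {ω : Set V} (h : ∀ s ∈ S, ∀ t ∈ T, t ∉ siteCluster Γ ω s) :
    setC Γ Finset.univ T (ω \ worldDead Γ S ω) = setC Γ Finset.univ T ω := by
  ext u
  simp only [mem_setC, sC_univ]
  refine exists_congr fun t => and_congr_right fun ht => ?_
  have havoid : ω ∈ SiteCSH.avoid Γ t S := fun s hs hst => h s hs t ht (siteRel_symm ω _ _ hst)
  rw [siteCluster_world_of_avoid havoid]

/-- `{S ↮ T}` is a function of the cluster of `S`: it says `T ∩ C_S = ∅`. [folklore] -/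
theorem notJoined_iff_forall_not_mem_setC (S T : Set V) (ω : Set V) :
    (∀ s ∈ S, ∀ t ∈ T, t ∉ siteCluster Γ ω s) ↔ ∀ t ∈ T, t ∉ setC Γ Finset.univ S ω := by
  simp only [mem_setC, sC_univ, not_exists, not_and]
  exact ⟨fun h t ht s hs => h s hs t ht, fun h s hs t ht => h t ht s hs⟩

/-- **The site sampler half-step as an exact identity** (Lemma 2.4 summed, two clusters): for any `H`,
`E[H(C_S, C_T) 1{S ↮ T}] = Σ_ω w(ω) 1{S ↮ T}(ω) · Σ_η w(η) H(C_S(ω), C_T(η ∖ deadOf S (C_S ω)))`.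
[cite: VandenbergHaggstromKahn2005, §2.1 Lemma 2.4 (p. 10) and the transition rule (pp. 10–11)] -/
theorem set_sum_cond_cluster (w : V → ℝ) (hm : ∑ ω, weight w ω = 1) (S T : Set V)
    (H : Set V → Set V → ℝ) {D : Set (Set V)} (hD : ∀ ω, ω ∈ D ↔ ∀ s ∈ S, ∀ t ∈ T, t ∉ siteCluster Γ ω s) :
    ∑ ω, weight w ω * (H (setC Γ Finset.univ S ω) (setC Γ Finset.univ T ω) * ind D ω) =
      ∑ ω, weight w ω * ((∑ η, weight w η *
        H (setC Γ Finset.univ S ω) (setC Γ Finset.univ T (η \ deadOf Γ S (setC Γ Finset.univ S ω)))) * ind D ω) := by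
  -- kernel `K(W, β) = 1{T ∩ W = ∅} · H(W, C_T(β))`
  set K : Set V → Set V → ℝ := fun W β => (if ∀ t ∈ T, t ∉ W then 1 else 0) * H W (setC Γ Finset.univ T β) with hK
  have hind : ∀ ω, ind D ω = if ∀ t ∈ T, t ∉ setC Γ Finset.univ S ω then 1 else 0 := by
    intro ω
    by_cases h : ∀ t ∈ T, t ∉ setC Γ Finset.univ S ω
    · rw [if_pos h, ind_of_mem ((hD ω).2 ((notJoined_iff_forall_not_mem_setC S T ω).2 h))]
    · rw [if_neg h, ind_of_not_mem fun h' => h ((notJoined_iff_forall_not_mem_setC S T ω).1 ((hD ω).1 h'))]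
  have key := set_sum_cond w hm S K (Γ := Γ)
  have hL : ∀ ω, weight w ω * K (setC Γ Finset.univ S ω) (ω \ worldDead Γ S ω) =
      weight w ω * (H (setC Γ Finset.univ S ω) (setC Γ Finset.univ T ω) * ind D ω) := by
    intro ω
    simp only [hK]
    rw [hind]
    by_cases h : ∀ t ∈ T, t ∉ setC Γ Finset.univ S ω
    · rw [if_pos h, setC_world_eq_of_notJoined ((notJoined_iff_forall_not_mem_setC S T ω).2 h)]; ring
    · rw [if_neg h]; ring
  have hR : ∀ ω, weight w ω * ∑ η, weight w η * K (setC Γ Finset.univ S ω) (η \ worldDead Γ S ω) =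
      weight w ω * ((∑ η, weight w η *
        H (setC Γ Finset.univ S ω) (setC Γ Finset.univ T (η \ deadOf Γ S (setC Γ Finset.univ S ω)))) * ind D ω) := by
    intro ω
    simp only [hK]
    rw [hind, worldDead_eq_deadOf, Finset.sum_mul]
    congr 1
    exact Finset.sum_congr rfl fun η _ => by ring
  calc _ = ∑ ω, weight w ω * K (setC Γ Finset.univ S ω) (ω \ worldDead Γ S ω) :=
        Finset.sum_congr rfl fun ω _ => (hL ω).symm
    _ = ∑ ω, weight w ω * ∑ η, weight w η * K (setC Γ Finset.univ S ω) (η \ worldDead Γ S ω) := key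
    _ = _ := Finset.sum_congr rfl fun ω _ => hR ω

/-- **The other half-step** (roles of `S` and `T` exchanged). [cite: VandenbergHaggstromKahn2005, §2.1 pp. 10–11] -/
theorem set_sum_cond_cluster' (w : V → ℝ) (hm : ∑ ω, weight w ω = 1) (S T : Set V)
    (H : Set V → Set V → ℝ) {D : Set (Set V)} (hD : ∀ ω, ω ∈ D ↔ ∀ s ∈ S, ∀ t ∈ T, t ∉ siteCluster Γ ω s) :
    ∑ ω, weight w ω * (H (setC Γ Finset.univ S ω) (setC Γ Finset.univ T ω) * ind D ω) =
      ∑ ω, weight w ω * ((∑ η, weight w η *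
        H (setC Γ Finset.univ S (η \ deadOf Γ T (setC Γ Finset.univ T ω))) (setC Γ Finset.univ T ω)) * ind D ω) := by
  have hD' : ∀ ω, ω ∈ D ↔ ∀ t ∈ T, ∀ s ∈ S, s ∉ siteCluster Γ ω t := fun ω => by
    rw [hD]
    exact ⟨fun h t ht s hs hst => h s hs t ht (siteRel_symm ω _ _ hst),
      fun h s hs t ht hts => h t ht s hs (siteRel_symm ω _ _ hts)⟩
  exact set_sum_cond_cluster w hm T S (fun B A => H A B) hD'

/-! ### Stationarity and the regeneration contraction -/

/-- Unfolding of `gibbsE`. [folklore] -/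
theorem gibbsE_apply (w : V → ℝ) (S T : Set V) (Φ : Set V × Set V → ℝ) (x : Set V × Set V) :
    gibbsE Γ w S T Φ x = ∑ η, weight w η * ∑ η', weight w η' * Φ (gibbsStep Γ S T x η η') := rfl

/-- **Stationarity of the site conditional pair law**: `E[Φ(C_S, C_T) 1{S ↮ T}] = E[(EΦ)(C_S, C_T) 1{S ↮ T}]`.
[cite: VandenbergHaggstromKahn2005, §2.1 p. 11 ("φ̂ is stationary for this chain"), Lemma 2.4 (p. 10)] -/
theorem gibbsE_stationary (w : V → ℝ) (hm : ∑ ω, weight w ω = 1) (S T : Set V)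
    (Φ : Set V × Set V → ℝ) {D : Set (Set V)} (hD : ∀ ω, ω ∈ D ↔ ∀ s ∈ S, ∀ t ∈ T, t ∉ siteCluster Γ ω s) :
    ∑ ω, weight w ω * (Φ (setC Γ Finset.univ S ω, setC Γ Finset.univ T ω) * ind D ω) =
      ∑ ω, weight w ω * (gibbsE Γ w S T Φ (setC Γ Finset.univ S ω, setC Γ Finset.univ T ω) * ind D ω) := by
  have e1 := set_sum_cond_cluster' w hm S T (fun A B => Φ (A, B)) hD (Γ := Γ)
  have e2 := set_sum_cond_cluster w hm S T
    (fun _ B => ∑ η', weight w η' * Φ (halfS Γ S T B η', B)) hD (Γ := Γ)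
  rw [e1]
  simpa only [gibbsE, gibbsStep, halfT, halfS] using e2

/-- **Stationarity, iterated.** [cite: VandenbergHaggstromKahn2005, §2.1 p. 11] -/
theorem gibbsE_iterate_stationary (w : V → ℝ) (hm : ∑ ω, weight w ω = 1) (S T : Set V)
    {D : Set (Set V)} (hD : ∀ ω, ω ∈ D ↔ ∀ s ∈ S, ∀ t ∈ T, t ∉ siteCluster Γ ω s)
    (n : ℕ) (Φ : Set V × Set V → ℝ) :
    ∑ ω, weight w ω * (Φ (setC Γ Finset.univ S ω, setC Γ Finset.univ T ω) * ind D ω) =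
      ∑ ω, weight w ω * ((gibbsE Γ w S T)^[n] Φ (setC Γ Finset.univ S ω, setC Γ Finset.univ T ω) * ind D ω) := by
  induction n generalizing Φ with
  | zero => rfl
  | succ n ih =>
    rw [Function.iterate_succ_apply, ← ih (gibbsE Γ w S T Φ)]
    exact gibbsE_stationary w hm S T Φ hD

/-- **Regeneration contraction**: one step of the site chain contracts oscillations by `1 − ε`. [folklore] (Doeblin coupling)
[cite: VandenbergHaggstromKahn2005, §2.1 p. 11] -/
theorem gibbsE_sub_le {w : V → ℝ} (hw0 : ∀ u, 0 ≤ w u) (hw1 : ∀ u, w u ≤ 1)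
    (hm : ∑ ω, weight w ω = 1) (S T : Set V) {Φ : Set V × Set V → ℝ} {c : ℝ}
    (hΦ : ∀ x y, Φ x - Φ y ≤ c) (x y : Set V × Set V) :
    gibbsE Γ w S T Φ x - gibbsE Γ w S T Φ y ≤ (1 - regenWeight w T) * c := by
  have hin : ∀ η, ∑ η', weight w η' * Φ (gibbsStep Γ S T x η η') -
      ∑ η', weight w η' * Φ (gibbsStep Γ S T y η η') ≤ (1 - ind (regenT T) η) * c := by
    intro η
    by_cases hη : η ∈ regenT T
    · simp only [gibbsStep_of_mem_regenT S T hη, sub_self, ind_of_mem hη, zero_mul, le_refl]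
    · rw [ind_of_not_mem hη, sub_zero, one_mul, ← Finset.sum_sub_distrib]
      calc ∑ η', (weight w η' * Φ (gibbsStep Γ S T x η η') - weight w η' * Φ (gibbsStep Γ S T y η η'))
          = ∑ η', weight w η' * (Φ (gibbsStep Γ S T x η η') - Φ (gibbsStep Γ S T y η η')) :=
            Finset.sum_congr rfl fun η' _ => by ring
        _ ≤ ∑ η', weight w η' * c := Finset.sum_le_sum fun η' _ =>
            mul_le_mul_of_nonneg_left (hΦ _ _) (weight_nonneg hw0 hw1 η')
        _ = c := by rw [← Finset.sum_mul, hm, one_mul]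
  rw [gibbsE_apply, gibbsE_apply, ← Finset.sum_sub_distrib]
  calc ∑ η, (weight w η * ∑ η', weight w η' * Φ (gibbsStep Γ S T x η η') -
        weight w η * ∑ η', weight w η' * Φ (gibbsStep Γ S T y η η'))
      = ∑ η, weight w η * (∑ η', weight w η' * Φ (gibbsStep Γ S T x η η') -
          ∑ η', weight w η' * Φ (gibbsStep Γ S T y η η')) :=
        Finset.sum_congr rfl fun η _ => by ring
    _ ≤ ∑ η, weight w η * ((1 - ind (regenT T) η) * c) := Finset.sum_le_sum fun η _ =>
        mul_le_mul_of_nonneg_left (hin η) (weight_nonneg hw0 hw1 η)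
    _ = (1 - regenWeight w T) * c := by
        have : ∀ η, weight w η * ((1 - ind (regenT T) η) * c) =
            c * weight w η - c * (weight w η * ind (regenT T) η) := fun η => by ring
        simp only [this, Finset.sum_sub_distrib, ← Finset.mul_sum, hm, regenWeight]
        ring

/-- **Regeneration contraction, iterated**: `osc(EⁿΦ) ≤ (1 − ε)ⁿ osc(Φ)`. [folklore] (Doeblin coupling)
[cite: VandenbergHaggstromKahn2005, §2.1 p. 11] -/
theorem gibbsE_iterate_sub_le {w : V → ℝ} (hw0 : ∀ u, 0 ≤ w u) (hw1 : ∀ u, w u ≤ 1)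
    (hm : ∑ ω, weight w ω = 1) (S T : Set V) (n : ℕ) {Φ : Set V × Set V → ℝ}
    {c : ℝ} (hΦ : ∀ x y, Φ x - Φ y ≤ c) (x y : Set V × Set V) :
    (gibbsE Γ w S T)^[n] Φ x - (gibbsE Γ w S T)^[n] Φ y ≤ (1 - regenWeight w T) ^ n * c := by
  induction n generalizing Φ c with
  | zero => simpa using hΦ x y
  | succ n ih =>
    rw [Function.iterate_succ_apply]
    calc (gibbsE Γ w S T)^[n] (gibbsE Γ w S T Φ) x - (gibbsE Γ w S T)^[n] (gibbsE Γ w S T Φ) y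
        ≤ (1 - regenWeight w T) ^ n * ((1 - regenWeight w T) * c) :=
          ih (gibbsE_sub_le hw0 hw1 hm S T hΦ)
      _ = (1 - regenWeight w T) ^ (n + 1) * c := by ring

end SiteGibbs

end Summit.CriticalPhenomena.PercolationContinuityZ3.Theorems.Transplant
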